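import Summits.AtomisticToContinuum.HydrodynamicLimit.Theorems.CollisionIsometryCLTAdaptedWeightCLTBHEEPClosurePointwise
import Summits.AtomisticToContinuum.HydrodynamicLimit.Theorems.CollisionIsometryCLTAdaptedWeightCLTTLPastDampingScales

/-!
# Stub `stub_eepClosure` (S5) of the line `block-h-dissipation-closure` for the crux `AdaptedWeightCLT`
(stmt-AtomisticToContinuum-14868, rev-12 TIME-LOCAL form; route `CollisionIsometryCLT`, sub-problem `HydrodynamicLimit`;
`--supports`): the transfer `C⁺ ⇒ C` AT CELL SCALE, CONDITIONAL on Villani's entropy–entropy-production inequality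

`bhEEPClosure_conditional : HardSphereEEP → EEPClosureStub` (the registered signature of `stub_eepClosure` verbatim
after the named literature fact `HardSphereEEP` (Villani's entropy–entropy-production inequality for hard spheres,
special-cased to regularised cloud laws; stated in helper file 9 and relocated by the gate under `Literature/`), taken as a hypothesis — the registered signature
carries no EEP hypothesis, so the stub is landed in this conditional, anchored form, re-scoped by the line lead).
For nice profiles, `0 < σ < 1/2`, an admissible cell family `ψ` at exponent `γc ∈ (1/6, 1/3)`, fixed
`(h, δ) ∈ (0,1)²`, every flow family and horizon `t > 0` with H2 (`TailsOn`): `DissipSmallOn ⇒ KineticClosureOn ψ`.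
PROOF (analysis of functionals only, no dynamics). For `δ' > 0` choose, backwards, `ε` (good-cell defect),
`η` and `L_c` (UI split of the sixth moment against the Gaussian moment of H2, helper 11), `R` (Gaussian-moment
threshold of good cells), `κ` (dissipation threshold: the CELL CLOSURE of helper 9 — steps (i) entropy production
`≤` Hellinger dissipation + tail, (ii) `HardSphereEEP`, (iii) parametric Csiszár–Kullback–Pinsker + truncation,
(iv) the exact `(1−δ)` moment identities) and `m₀` (mass-dissipation threshold). Then for `N` large (cell radius and
sphere diameter small, landed `PastDamping.eventually_small_radius`) and every good `z` with time-integrated Gaussian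
moment `≤ C_exp` and `massDiss ≤ m₀`, the PATHWISE BOUND of helper 11 (pointwise split `DefectSq = ρ̄² cloudDefect ≤
ρ_max (ε ρ̄ + 1024 (L_c/R + η) ρ̄ Mexp + (1024 L_c/κ) ρ̄ 𝒟h)`, hard-core density cap `ρ̄ ≤ 27 C' σ⁻³`, landed
`PastDamping.sum_wgt_le_uniform`) gives `∫₀ᵗ∫ₓ (Σ D² + |q|²) ≤ δ'` (the crux integrand IS `DefectSq`, landed
`Reduction.cruxIntegrand_eq`); so the crux's event lies in `goodᶜ ∪ {C_exp < TE} ∪ {m₀ < massDiss}`, of local-Gibbs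
measure `0 + o(1) + o(1)` (`localGibbsLaw ≪ liouville`, `TailsOn`, `DissipSmallOn`). `NiceProfiles` is not used.
-/

namespace Summit.AtomisticToContinuum.HydrodynamicLimit.Theorems.BlockHDissipation

open scoped BigOperators Topology Classical MeasureTheory ENNReal InnerProductSpace
open Filter Set MeasureTheory Real
open Literature.Analysis.FluidPDE
open Summit.AtomisticToContinuum.HydrodynamicLimit.Theorems.ContactSourceDuhamel (T3 V3 Cfg Vel Flow Flows wgt DefectSq)
open Summit.AtomisticToContinuum.HydrodynamicLimit.Theorems.ContactSourceDuhamel.TimeLocal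
open Summit.AtomisticToContinuum.HydrodynamicLimit.Theorems.ContactSourceDuhamel.TimeLocal.Reduction (cruxIntegrand_eq)
open Summit.AtomisticToContinuum.HydrodynamicLimit.Theorems.ContactSourceDuhamel.TimeLocal.PastDamping
  (sum_wgt_le_uniform flow_mem_hardSphereDomain eventually_small_radius)
open Literature.MathematicalPhysics.KineticTheory (hsDiameter localGibbsLaw localGibbsLaw_absolutelyContinuous)
open Literature.MathematicalPhysics.KineticTheory (HardSphereEEP)

noncomputable section

namespace EEP

/-- Pure bookkeeping of the four quarters of `δ'`: with the constants chosen backwards as in the main proof,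
`ρ_m (ε t + 1024 (L_c/R + η) C_x + (1024 L_c/κ) m₀) ≤ δ'`. -/
theorem quarters_le {δ' t ρm Cx Lc R κ ε η m₀ : ℝ} (hδ' : 0 < δ') (ht : 0 < t) (hρm : 0 < ρm) (hCx : 0 < Cx)
    (hLc : 0 ≤ Lc) (hκ : 0 < κ) (hε : ε = δ' / (4 * ρm * t)) (hη : η = δ' / (4 * 1024 * ρm * Cx))
    (hR : 4 * 1024 * ρm * Lc * Cx / δ' ≤ R) (hR0 : 0 < R) (hm₀ : m₀ = δ' * κ / (4 * 1024 * ρm * (Lc + 1))) :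
    ρm * (ε * t + 1024 * (Lc / R + η) * Cx + 1024 * Lc / κ * m₀) ≤ δ' := by
  have q1 : ρm * (ε * t) = δ' / 4 := by rw [hε]; field_simp
  have q2 : ρm * (1024 * η * Cx) = δ' / 4 := by rw [hη]; field_simp
  have q3 : ρm * (1024 * (Lc / R) * Cx) ≤ δ' / 4 := by
    rw [div_le_iff₀ hδ'] at hR
    rw [show ρm * (1024 * (Lc / R) * Cx) = (1024 * ρm * Lc * Cx) / R by field_simp, div_le_iff₀ hR0]
    nlinarith
  have q4 : ρm * (1024 * Lc / κ * m₀) ≤ δ' / 4 := by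
    rw [hm₀, show ρm * (1024 * Lc / κ * (δ' * κ / (4 * 1024 * ρm * (Lc + 1)))) = δ' / 4 * (Lc / (Lc + 1)) by
      field_simp]
    have : Lc / (Lc + 1) ≤ 1 := by rw [div_le_one (by linarith)]; linarith
    exact mul_le_of_le_one_right (by positivity) this
  have hsplit : ρm * (ε * t + 1024 * (Lc / R + η) * Cx + 1024 * Lc / κ * m₀) =
      ρm * (ε * t) + ρm * (1024 * (Lc / R) * Cx) + ρm * (1024 * η * Cx) + ρm * (1024 * Lc / κ * m₀) := by ring
  rw [hsplit]
  linarith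

end EEP

/-- **S5 — ENTROPY–ENTROPY-PRODUCTION CLOSURE AT CELL SCALE, conditional on Villani's EEP inequality** (registered
anchor `bhEEPClosure_conditional` = `HardSphereEEP →` the registered signature of `stub_eepClosure` verbatim). For nice
profiles, `0 < σ < 1/2`, an admissible cell family at exponent `γc ∈ (1/6, 1/3)`, fixed `(h, δ) ∈ (0,1)²`, every flow
family and `t > 0` with H2 on `[0,t]`: `DissipSmallOn ⇒ KineticClosureOn ψ`. See the module docstring for the proof. -/
theorem bhEEPClosure_conditional : HardSphereEEP → ∀ (a₀ θ₀ : T3 → ℝ) (u₀ : T3 → V3), NiceProfiles a₀ θ₀ u₀ → ∀ σ : ℝ, 0 < σ → σ < 2⁻¹ → ∀ (γc C' : ℝ) (ψ : ℕ → T3 → ℝ), 1 / 6 < γc → γc < 1 / 3 → AdmissibleKernel γc C' ψ → ∀ h δ : ℝ, 0 < h → h < 1 → 0 < δ → δ < 1 → ∀ (Φ : Flows σ) (t : ℝ), 0 < t → TailsOn σ a₀ θ₀ u₀ Φ t → DissipSmallOn σ a₀ θ₀ u₀ Φ ψ h δ t → KineticClosureOn σ a₀ θ₀ u₀ Φ ψ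 t := by
  intro hEEP a₀ θ₀ u₀ _ σ hσ hσ2 γc C' ψ hγ1 hγ3 hadm h δ hh hh1 hδ hδ1 Φ t ht hT hDiss
  unfold KineticClosureOn
  intro ρb mb ub D q δ' hδ'
  -- step 0: the crux integrand is `DefectSq`
  have hint : ∀ n s z x, ((∑ j, ∑ k, D n s z x j k ^ 2) + ‖q n s z x‖ ^ 2) = DefectSq σ n (Φ n) ψ s z x :=
    fun n s z x => cruxIntegrand_eq (Φ n) ψ s z x
  simp only [hint]
  -- step 1: constants, chosen backwards from `δ'`
  obtain ⟨lam, Cexp, hlam, hTails⟩ := hT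
  have hσ1 : σ ≤ 1 := by linarith
  have hγpos : 0 < γc := by linarith
  have hγ3' : γc ≤ 1 / 3 := hγ3.le
  have hC' : 0 ≤ C' := by
    have h0 := (hadm.2.1 0 0).trans (hadm.2.2.2.2.1 0 0)
    have hpow : 0 < ((0 : ℕ) + 1 : ℝ) ^ (3 * γc) := Real.rpow_pos_of_pos (by norm_num) _
    nlinarith
  set ρmax : ℝ := 27 * C' * σ⁻¹ ^ 3 with hρmax
  have hρmax0 : 0 ≤ ρmax := by positivity
  set ρm : ℝ := max ρmax 1 with hρm
  have hρm0 : 0 < ρm := lt_of_lt_of_le one_pos (le_max_right _ _)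
  have hρle : ρmax ≤ ρm := le_max_left _ _
  set Cx : ℝ := max Cexp 1 with hCx
  have hCx0 : 0 < Cx := lt_of_lt_of_le one_pos (le_max_right _ _)
  have hCle : Cexp ≤ Cx := le_max_left _ _
  set ε : ℝ := δ' / (4 * ρm * t) with hε
  have hε0 : 0 < ε := by positivity
  set η : ℝ := δ' / (4 * 1024 * ρm * Cx) with hη
  have hη0 : 0 < η := by positivity
  obtain ⟨Lc, hLc0, hUI⟩ := EEP.exists_ui_split hlam hη0
  set R : ℝ := max 1 (4 * 1024 * ρm * Lc * Cx / δ') with hR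
  have hR0 : 0 < R := lt_of_lt_of_le one_pos (le_max_left _ _)
  have hRge : 4 * 1024 * ρm * Lc * Cx / δ' ≤ R := le_max_right _ _
  obtain ⟨κ, hκ0, hcell⟩ := EEP.exists_cloudDefect_le_of_hellDiss_le hEEP hh hh1 hδ hδ1 hlam R hε0
  set m₀ : ℝ := δ' * κ / (4 * 1024 * ρm * (Lc + 1)) with hm₀
  have hm₀0 : 0 < m₀ := by positivity
  have hquart : ρm * (ε * t + 1024 * (Lc / R + η) * Cx + 1024 * Lc / κ * m₀) ≤ δ' :=
    EEP.quarters_le hδ' ht hρm0 hCx0 hLc0 hκ0 hε hη hRge hR0 hm₀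
  -- step 2: the two vanishing probabilities
  have hB1 := hTails
  have hB2 := hDiss m₀ hm₀0
  refine tendsto_of_tendsto_of_tendsto_of_le_of_le' tendsto_const_nhds (by simpa using hB1.add hB2)
    (Eventually.of_forall fun _ => bot_le) ?_
  -- step 3: eventually in `N`, the crux's event lies in `goodᶜ ∪ {Cexp < TE} ∪ {m₀ < massDiss}`
  filter_upwards [eventually_small_radius hγpos σ] with N hN
  have hnull : localGibbsLaw σ a₀ u₀ θ₀ N (Φ N) (Φ N).goodᶜ = 0 :=
    ae_iff.1 ((localGibbsLaw_absolutelyContinuous σ a₀ u₀ θ₀ N (Φ N)).ae_le (Φ N).ae_mem_good)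
  have hsub : {z | δ' < ∫ s in Icc 0 t, ∫ x, DefectSq σ N (Φ N) ψ s z x} ⊆
      ((Φ N).goodᶜ ∪ {z | Cexp < ∫ s in Icc 0 t, ∫ y, Real.exp (lam * ‖y.2‖ ^ 2)
        ∂(empiricalMeasure ((Φ N).flow s z))}) ∪ {z | m₀ < massDiss σ N (Φ N) ψ h δ t z} := by
    intro z hzE
    by_contra hnot
    simp only [mem_union, mem_compl_iff, mem_setOf_eq, not_or, not_not, not_lt] at hnot
    obtain ⟨⟨hz, hTE⟩, hMD⟩ := hnot
    -- density cap along the orbit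
    have hcap : ∀ s ∈ Icc 0 t, ∀ x, ((N + 1 : ℕ) : ℝ)⁻¹ * cW N ψ ((Φ N).flow s z) x ≤ ρmax := by
      intro s _ x
      have h1 := sum_wgt_le_uniform hσ hσ1 (Φ N) hadm hγ3' hN.2 s z (flow_mem_hardSphereDomain (Φ N) hz s) x
      have hNpos : (0 : ℝ) < ((N + 1 : ℕ) : ℝ) := by positivity
      rw [hρmax, inv_mul_le_iff₀ hNpos]
      calc cW N ψ ((Φ N).flow s z) x = ∑ i, wgt σ N (Φ N) ψ s z x i := rfl
        _ ≤ 27 * C' * σ⁻¹ ^ 3 * ((N + 1 : ℕ) : ℝ) := h1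
        _ = ((N + 1 : ℕ) : ℝ) * (27 * C' * σ⁻¹ ^ 3) := by ring
    have hmain := EEP.setIntegral_defectSq_le hadm hz hδ.le hδ1.le ht.le hR0 hκ0 hε0.le hLc0 hη0.le hρmax0 hcap hUI hcell
    -- numbers
    have hTE' : ∫ s in Icc 0 t, ∫ y, Real.exp (lam * ‖y.2‖ ^ 2) ∂(empiricalMeasure ((Φ N).flow s z)) ≤ Cx :=
      hTE.trans hCle
    have hfac0 : 0 ≤ ε * t + 1024 * (Lc / R + η) *
        (∫ s in Icc 0 t, ∫ y, Real.exp (lam * ‖y.2‖ ^ 2) ∂(empiricalMeasure ((Φ N).flow s z))) +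
        1024 * Lc / κ * massDiss σ N (Φ N) ψ h δ t z := by
      have hTE0 : 0 ≤ ∫ s in Icc 0 t, ∫ y, Real.exp (lam * ‖y.2‖ ^ 2) ∂(empiricalMeasure ((Φ N).flow s z)) :=
        integral_nonneg fun s => integral_nonneg fun y => (Real.exp_pos _).le
      have hMD0 : 0 ≤ massDiss σ N (Φ N) ψ h δ t z := ContactToMass.massDiss_nonneg hadm.2.1 (Φ N) hδ.le hδ1.le t z
      positivity
    have hle : ∫ s in Icc 0 t, ∫ x, DefectSq σ N (Φ N) ψ s z x ≤ δ' := by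
      refine hmain.trans (le_trans ?_ hquart)
      calc ρmax * (ε * t + 1024 * (Lc / R + η) *
            (∫ s in Icc 0 t, ∫ y, Real.exp (lam * ‖y.2‖ ^ 2) ∂(empiricalMeasure ((Φ N).flow s z))) +
            1024 * Lc / κ * massDiss σ N (Φ N) ψ h δ t z)
          ≤ ρm * (ε * t + 1024 * (Lc / R + η) *
            (∫ s in Icc 0 t, ∫ y, Real.exp (lam * ‖y.2‖ ^ 2) ∂(empiricalMeasure ((Φ N).flow s z))) +
            1024 * Lc / κ * massDiss σ N (Φ N) ψ h δ t z) := mul_le_mul_of_nonneg_right hρle hfac0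
        _ ≤ ρm * (ε * t + 1024 * (Lc / R + η) * Cx + 1024 * Lc / κ * m₀) := by
            refine mul_le_mul_of_nonneg_left ?_ hρm0.le
            have h1 : 1024 * (Lc / R + η) *
                (∫ s in Icc 0 t, ∫ y, Real.exp (lam * ‖y.2‖ ^ 2) ∂(empiricalMeasure ((Φ N).flow s z))) ≤
                1024 * (Lc / R + η) * Cx := mul_le_mul_of_nonneg_left hTE' (by positivity)
            have h2 : 1024 * Lc / κ * massDiss σ N (Φ N) ψ h δ t z ≤ 1024 * Lc / κ * m₀ :=
              mul_le_mul_of_nonneg_left hMD (by positivity)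
            linarith
    exact (not_le.2 hzE) hle
  calc localGibbsLaw σ a₀ u₀ θ₀ N (Φ N) {z | δ' < ∫ s in Icc 0 t, ∫ x, DefectSq σ N (Φ N) ψ s z x}
      ≤ localGibbsLaw σ a₀ u₀ θ₀ N (Φ N)
          (((Φ N).goodᶜ ∪ {z | Cexp < ∫ s in Icc 0 t, ∫ y, Real.exp (lam * ‖y.2‖ ^ 2)
            ∂(empiricalMeasure ((Φ N).flow s z))}) ∪ {z | m₀ < massDiss σ N (Φ N) ψ h δ t z}) := measure_mono hsub
    _ ≤ localGibbsLaw σ a₀ u₀ θ₀ N (Φ N) (Φ N).goodᶜ +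
          localGibbsLaw σ a₀ u₀ θ₀ N (Φ N) {z | Cexp < ∫ s in Icc 0 t, ∫ y, Real.exp (lam * ‖y.2‖ ^ 2)
            ∂(empiricalMeasure ((Φ N).flow s z))} +
          localGibbsLaw σ a₀ u₀ θ₀ N (Φ N) {z | m₀ < massDiss σ N (Φ N) ψ h δ t z} :=
        (measure_union_le _ _).trans (add_le_add (measure_union_le _ _) le_rfl)
    _ = _ := by rw [hnull, zero_add]

end

end Summit.AtomisticToContinuum.HydrodynamicLimit.Theorems.BlockHDissipation
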